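import Literature.NumberTheory.Automorphic.IdeleNormTowerProofs
import Literature.NumberTheory.Automorphic.GaloisActionPlaces
import Literature.NumberTheory.GaloisRepresentations.IdelicLocalNorm
import Mathlib.NumberTheory.RamificationInertia.Galois
import HarnessLib

/-!
# The finite places of a quadratic Galois extension `L/K` above a place of `K`: `{w, τw}` and `n·e·f = 2`

Topic `NumberTheory/NumberFields` (namespace `Literature.NumberTheory.NumberFields`). PROOFS ONLY (no definition, no
named fact, no `sorry`). The relative form of the tree's `placesOver_trichotomy_of_finrank_eq_two`
(`EllipticCurves/ComplexMultiplicationDeuringLocalPlaces`, base `ℚ`), phrased with a GIVEN non-trivial automorphism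
`τ` of the quadratic Galois extension `L/K` (so `Gal(L/K) = {1, τ}`):

* `algEquiv_eq_one_or_eq_of_finrank_eq_two` — every `σ ∈ Gal(L/K)` is `1` or `τ`.
* `setOf_under_eq_pair` — for `w ∣ v`: `{w' ∣ v} = {w, τ • w}` (transitivity of `Gal(L/K)` on the fibre).
* `ramificationIdx_eq_one_and_inertiaDeg_eq_one_of_smul_ne`, `ramificationIdx_mul_inertiaDeg_eq_two_of_smul_eq` —
  the fundamental identity `#{w ∣ v} · e(w|v) · f(w|v) = 2`: two places force `e = f = 1`, one place forces `e·f = 2`.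
* `finprod_mem_setOf_under_eq` — `∏ᶠ_{w' ∣ v} g(w') = g(w)` or `g(w) g(τw)` accordingly.
* `under_smul_eq_restrictNormal_smul_under` — for a tower `F ⊂ K₁ ⊂ L` with `K₁/F` normal and `τ ∈ Aut(L/K)` (`K` any
  intermediate field over `F`): `(τ • w) ∩ 𝓞 K₁ = τ|_{K₁} • (w ∩ 𝓞 K₁)` (the tree's `HeightOneSpectrum.under_tower_smul`).

Requested by route `BiquadraticEisensteinDescent` of `Summits/BirchSwinnertonDyer` (crux `EisensteinHeartFlatCMInertBadKPrime`,
hypothesis (L): the primes of the biquadratic field `L = K_CM·K′` above a prime of `K′`, and their traces on `K_CM`).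

References: [NeukirchANT1999] Ch. I §8 (8.2)–(8.4), §9 (9.1); [CasselsFrohlichANT1967] Ch. VII §1.1, Prop. 1.2;
[Marcus2018] Ch. 3 Thm. 25, Ch. 4.
-/

noncomputable section

open scoped NumberField Pointwise
open NumberField IsDedekindDomain
open Literature.NumberTheory.Automorphic Literature.NumberTheory.GaloisRepresentations

namespace Literature.NumberTheory.NumberFields

section Quadratic

variable {K L : Type} [Field K] [Field L] [NumberField K] [NumberField L] [Algebra K L] [IsGalois K L]

/-- In a quadratic Galois extension every automorphism is `1` or the given non-trivial `τ` (`#Gal(L/K) = [L:K] = 2`).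
[cite: NeukirchANT1999, Ch. I §9 (9.1)] -/
theorem algEquiv_eq_one_or_eq_of_finrank_eq_two (h2 : Module.finrank K L = 2) {τ : L ≃ₐ[K] L} (hτ : τ ≠ 1)
    (σ : L ≃ₐ[K] L) : σ = 1 ∨ σ = τ := by
  classical
  by_contra h
  have h' : σ ≠ 1 ∧ σ ≠ τ := not_or.mp h
  have hcard : Fintype.card (L ≃ₐ[K] L) = 2 := by
    rw [← Nat.card_eq_fintype_card, IsGalois.card_aut_eq_finrank, h2]
  have h3 : ({1, τ, σ} : Finset (L ≃ₐ[K] L)).card = 3 := by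
    rw [Finset.card_insert_of_notMem (by simp [hτ.symm, h'.1.symm]),
      Finset.card_insert_of_notMem (by simp [h'.2.symm]), Finset.card_singleton]
  have := Finset.card_le_univ ({1, τ, σ} : Finset (L ≃ₐ[K] L))
  rw [h3, hcard] at this
  omega

/-- **The places above `v` are `w` and `τw`**: for `L/K` quadratic Galois with non-trivial automorphism `τ` and `w ∣ v`,
`{w' : w' ∩ 𝓞 K = v} = {w, τ • w}` (`Gal(L/K)` acts transitively on the fibre).
[cite: CasselsFrohlichANT1967, Ch. VII Prop. 1.2 (ii)] -/
theorem setOf_under_eq_pair (h2 : Module.finrank K L = 2) {τ : L ≃ₐ[K] L} (hτ : τ ≠ 1)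
    {w : HeightOneSpectrum (𝓞 L)} {v : HeightOneSpectrum (𝓞 K)} (hw : w.under (𝓞 K) = v) :
    {w' : HeightOneSpectrum (𝓞 L) | w'.under (𝓞 K) = v} = {w, τ • w} := by
  ext w'
  rw [Set.mem_setOf_eq, Set.mem_insert_iff, Set.mem_singleton_iff]
  constructor
  · intro hw'
    obtain ⟨σ, hσ⟩ := HeightOneSpectrum.exists_algEquiv_smul_eq (F := K) (hw.trans hw'.symm)
    rcases algEquiv_eq_one_or_eq_of_finrank_eq_two h2 hτ σ with rfl | rfl
    · left; rw [← hσ, one_smul]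
    · right; exact hσ.symm
  · rintro (rfl | rfl)
    · exact hw
    · rw [HeightOneSpectrum.under_algEquiv_smul, hw]

/-- The fundamental identity for the fibre of `v` in the quadratic Galois extension: `n · (e · f) = 2` with `n` the number
of places above `v`, `e = e(w|v)`, `f = f(w|v)` for any `w ∣ v`. [cite: NeukirchANT1999, Ch. I §8 (8.2) and §9 (9.1)] -/
theorem ncard_mul_ramificationIdx_mul_inertiaDeg_eq_two (h2 : Module.finrank K L = 2)
    {w : HeightOneSpectrum (𝓞 L)} {v : HeightOneSpectrum (𝓞 K)} (hw : w.under (𝓞 K) = v) :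
    (v.asIdeal.primesOver (𝓞 L)).ncard * (w.asIdeal.ramificationIdx (𝓞 K) * w.asIdeal.inertiaDeg (𝓞 K)) = 2 := by
  haveI : v.asIdeal.IsMaximal := v.isMaximal
  haveI : w.asIdeal.LiesOver v.asIdeal := ⟨by rw [← hw]; rfl⟩
  haveI : IsGaloisGroup (L ≃ₐ[K] L) (𝓞 K) (𝓞 L) := IsGaloisGroup.of_isFractionRing _ _ _ K L
  have hG : Nat.card (L ≃ₐ[K] L) = 2 := by rw [IsGalois.card_aut_eq_finrank, h2]
  rw [← Ideal.ramificationIdxIn_eq_ramificationIdx v.asIdeal w.asIdeal (L ≃ₐ[K] L),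
    ← Ideal.inertiaDegIn_eq_inertiaDeg v.asIdeal w.asIdeal (L ≃ₐ[K] L),
    Ideal.ncard_primesOver_mul_ramificationIdxIn_mul_inertiaDegIn v.asIdeal (𝓞 L) (L ≃ₐ[K] L), hG]

/-- The number of places above `v` is the number of elements of `{w, τ • w}`.
[cite: CasselsFrohlichANT1967, Ch. VII Prop. 1.2 (ii)] -/
theorem ncard_primesOver_eq (h2 : Module.finrank K L = 2) {τ : L ≃ₐ[K] L} (hτ : τ ≠ 1)
    {w : HeightOneSpectrum (𝓞 L)} {v : HeightOneSpectrum (𝓞 K)} (hw : w.under (𝓞 K) = v) :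
    (v.asIdeal.primesOver (𝓞 L)).ncard = ({w, τ • w} : Set (HeightOneSpectrum (𝓞 L))).ncard := by
  rw [← natCard_placesOver_eq_ncard_primesOver, ← Nat.card_coe_set_eq, ← setOf_under_eq_pair h2 hτ hw]
  rfl

/-- **Two places above `v` ⇒ `e(w|v) = f(w|v) = 1`.** [cite: NeukirchANT1999, Ch. I §8 (8.2) and §9 (9.1)] -/
theorem ramificationIdx_eq_one_and_inertiaDeg_eq_one_of_smul_ne (h2 : Module.finrank K L = 2) {τ : L ≃ₐ[K] L}
    (hτ : τ ≠ 1) {w : HeightOneSpectrum (𝓞 L)} {v : HeightOneSpectrum (𝓞 K)} (hw : w.under (𝓞 K) = v)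
    (hne : τ • w ≠ w) : w.asIdeal.ramificationIdx (𝓞 K) = 1 ∧ w.asIdeal.inertiaDeg (𝓞 K) = 1 := by
  have hid := ncard_mul_ramificationIdx_mul_inertiaDeg_eq_two h2 hw
  rw [ncard_primesOver_eq h2 hτ hw, Set.ncard_pair hne.symm] at hid
  have h1 : w.asIdeal.ramificationIdx (𝓞 K) * w.asIdeal.inertiaDeg (𝓞 K) = 1 := by omega
  exact ⟨Nat.eq_one_of_mul_eq_one_right h1, Nat.eq_one_of_mul_eq_one_left h1⟩

/-- **One place above `v` ⇒ `e(w|v) · f(w|v) = 2`.** [cite: NeukirchANT1999, Ch. I §8 (8.2) and §9 (9.1)] -/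
theorem ramificationIdx_mul_inertiaDeg_eq_two_of_smul_eq (h2 : Module.finrank K L = 2) {τ : L ≃ₐ[K] L}
    (hτ : τ ≠ 1) {w : HeightOneSpectrum (𝓞 L)} {v : HeightOneSpectrum (𝓞 K)} (hw : w.under (𝓞 K) = v)
    (heq : τ • w = w) : w.asIdeal.ramificationIdx (𝓞 K) * w.asIdeal.inertiaDeg (𝓞 K) = 2 := by
  have hid := ncard_mul_ramificationIdx_mul_inertiaDeg_eq_two h2 hw
  rw [ncard_primesOver_eq h2 hτ hw, heq, Set.pair_eq_singleton, Set.ncard_singleton, one_mul] at hid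
  exact hid

open scoped Classical in
/-- **The finite product over the places above `v`**: `∏ᶠ_{w' ∣ v} g(w') = g(w)` if `τw = w` and `= g(w) g(τw)` otherwise.
[cite: CasselsFrohlichANT1967, Ch. VII Prop. 1.2 (ii)] -/
theorem finprod_mem_setOf_under_eq {M : Type*} [CommMonoid M] (h2 : Module.finrank K L = 2) {τ : L ≃ₐ[K] L}
    (hτ : τ ≠ 1) {w : HeightOneSpectrum (𝓞 L)} {v : HeightOneSpectrum (𝓞 K)} (hw : w.under (𝓞 K) = v)
    (g : HeightOneSpectrum (𝓞 L) → M) :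
    ∏ᶠ w' ∈ {w' : HeightOneSpectrum (𝓞 L) | w'.under (𝓞 K) = v}, g w' =
      if τ • w = w then g w else g w * g (τ • w) := by
  rw [setOf_under_eq_pair h2 hτ hw]
  by_cases h : τ • w = w
  · rw [if_pos h, h, Set.pair_eq_singleton, finprod_mem_singleton]
  · rw [if_neg h]
    exact finprod_mem_pair (Ne.symm h)

end Quadratic

/-! ### A second subfield: traces on `K₁` of conjugate places -/

section Tower

variable {F K₁ L : Type} [Field F] [Field K₁] [Field L] [NumberField F] [NumberField K₁] [NumberField L]
  [Algebra F K₁] [Algebra K₁ L] [Algebra F L] [IsScalarTower F K₁ L] [Normal F K₁]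
  {K : Type} [Field K] [Algebra F K] [Algebra K L] [IsScalarTower F K L]

omit [NumberField F] [NumberField K₁] [NumberField L] [Algebra F K₁] [Algebra K₁ L] [IsScalarTower F K₁ L]
  [Normal F K₁] in
/-- Restricting scalars does not change the action on places. [folklore] -/
private theorem restrictScalars_smul (τ : L ≃ₐ[K] L) (w : HeightOneSpectrum (𝓞 L)) :
    (τ.restrictScalars F) • w = τ • w :=
  HeightOneSpectrum.ext (by
    rw [HeightOneSpectrum.smul_asIdeal, HeightOneSpectrum.smul_asIdeal]
    ext x
    rw [Ideal.mem_pointwise_smul_iff_inv_smul_mem, Ideal.mem_pointwise_smul_iff_inv_smul_mem]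
    rfl)

omit [NumberField F] [NumberField K₁] [NumberField L] in
/-- **Traces on `K₁` of conjugate places**: for `τ ∈ Aut(L/K)` (any subfield `K` of `L` over `F`) and a normal subfield
`K₁/F` of `L`, `(τ • w) ∩ 𝓞 K₁ = τ|_{K₁} • (w ∩ 𝓞 K₁)` with `τ|_{K₁} = (τ.restrictScalars F).restrictNormal K₁`.
[cite: CasselsFrohlichANT1967, Ch. VII §1.1] -/
theorem under_smul_eq_restrictNormal_smul_under (τ : L ≃ₐ[K] L) (w : HeightOneSpectrum (𝓞 L)) :
    (τ • w).under (𝓞 K₁) = (τ.restrictScalars F).restrictNormal K₁ • w.under (𝓞 K₁) := by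
  rw [← restrictScalars_smul (F := F) τ w]
  exact HeightOneSpectrum.under_tower_smul (K := F) (K' := K₁) (L := L) (τ.restrictScalars F) w

end Tower

end Literature.NumberTheory.NumberFields

end
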